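import Summits.PneNP.PneNP.Theorems.NegLimitedNearMarkovLanguage

/-!
# Route NegLimited — block-parity languages with a prescribed block length (generic T4 device)

`NegLimitedNearMarkovLanguage.lean` builds the T4 witness with the block length
`s(n) = min (2^{32 ⌊log₂ ⌊log₂ n⌋⌋} - 1) n + 1` hard-wired. This file is the same construction for an
ARBITRARY block-length function `s : ℕ → ℕ`, so that other rungs of the as-typed (unguarded)
negation ladder — first of all the aside item stmt-PneNP-0411 `NeglimitedEpsLogNegations` (budget
`⌊ε log₂ n⌋`, block length `2^{⌊log₂ n⌋ / 2}`) — are instances: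

* `blockParityLang s F`: strings `u` an odd number of whose `K = |u| / s(|u|)` consecutive blocks of
  length `s(|u|)` lie in the Tardos witness language `witnessLang F` (`NegLimitedLoglogSlices.lean`);
* `blockParityLang_mem_P` / `_mem_NP`: in `P ⊆ NP` as soon as SOME `FP` brick `sB` computes
  `u ↦ 1^{s(|u|)}` (the decider is the index-parity loop `parityIdxFn` of the block test);
* `bpBlock_ofFn`, `sliceFn_blockParityLang`: the slice at length `n` as the parity of the accepting
  blocks of the input word.

References: S. Arora, B. Barak, *Computational Complexity* (2009), §1.3 (bounded loops), Claim 2.4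
[AroraBarakCC2009]; S. Jukna, *Boolean Function Complexity* (2012), §10.5 Thm. 10.21 (the padded
`2^r`-fold device) [Jukna2012].
-/

set_option linter.dupNamespace false

noncomputable section

namespace Summit.PneNP.PneNP.Theorems.NegLimNearMarkov

open Literature.Computability.Complexity Literature.Computability.Complexity.Brick
  Literature.Computability.Complexity.Plumb Literature.Computability.Complexity.HashBricks
  Summit.PneNP.PneNP.Theorems.NegLimSlices _root_.Computability Polynomial Finset

variable (s : ℕ → ℕ)

/-! ## Blocks -/

/-- The number of blocks `K(n) = n / s(n)`. [folklore] -/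
def bpBlocks (n : ℕ) : ℕ := n / s n

/-- The `j`-th block of `u`: `s(|u|)` symbols from position `j · s(|u|)`. [folklore] -/
def bpBlock (u : List Bool) (j : ℕ) : List Bool :=
  (u.drop (j * s u.length)).take (s u.length)

/-- `K(n) ≤ n`. [folklore] -/
theorem bpBlocks_le (n : ℕ) : bpBlocks s n ≤ n := Nat.div_le_self _ _

variable {s}

/-- The block-count brick `bpKFn sB u = 1^{K(|u|)}` from a block-length brick `sB u = 1^{s(|u|)}`.
[folklore] -/
def bpKFn (sB : List Bool → List Bool) : List Bool → List Bool :=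
  fstF ∘ divModFn ∘ fanoutFn sB (polyFn X)

/-- Value of `bpKFn`. [folklore] -/
theorem bpKFn_apply {sB : List Bool → List Bool} (hsB : ∀ u, sB u = ones (s u.length))
    (u : List Bool) : bpKFn sB u = ones (bpBlocks s u.length) := by
  simp only [bpKFn, Function.comp_apply, fanoutFn_apply, hsB, polyFn_apply, eval_X,
    divModFn_boolPair, fstF_boolPair, bpBlocks]

/-- `bpKFn sB ∈ FP`. [folklore] -/
theorem bpKFn_mem_FP {sB : List Bool → List Bool} (hsB : sB ∈ FP) : bpKFn sB ∈ FP :=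
  comp_mem_FP fstF_mem_FP (comp_mem_FP divModFn_mem_FP (fanoutFn_mem_FP hsB (polyFn_mem_FP _)))

/-- The yardstick fits: `|bpKFn sB u| ≤ |u|`. [folklore] -/
theorem length_bpKFn_le {sB : List Bool → List Bool} (hsB : ∀ u, sB u = ones (s u.length))
    (u : List Bool) : (bpKFn sB u).length ≤ u.length := by
  rw [bpKFn_apply hsB]; simpa [ones] using bpBlocks_le s u.length

/-- The block-extraction brick `bpBlkFn sB ⟨u, 1ʲ⟩ = bpBlock s u j`. [folklore] -/
def bpBlkFn (sB : List Bool → List Bool) : List Bool → List Bool :=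
  takeFn ∘ fanoutFn (sB ∘ fstF) (dropFn ∘ fanoutFn (umulFn ∘ fanoutFn sndF (sB ∘ fstF)) fstF)

/-- Value of `bpBlkFn` on a round word. [folklore] -/
theorem bpBlkFn_apply {sB : List Bool → List Bool} (hsB : ∀ u, sB u = ones (s u.length))
    (u : List Bool) (j : ℕ) : bpBlkFn sB (boolPair u (ones j)) = bpBlock s u j := by
  simp only [bpBlkFn, Function.comp_apply, fanoutFn_apply, fstF_boolPair, sndF_boolPair, hsB,
    umulFn_boolPair, dropFn_boolPair, takeFn_boolPair, bpBlock]
  simp [ones]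

/-- `bpBlkFn sB ∈ FP`. [folklore] -/
theorem bpBlkFn_mem_FP {sB : List Bool → List Bool} (hsB : sB ∈ FP) : bpBlkFn sB ∈ FP :=
  comp_mem_FP takeFn_mem_FP (fanoutFn_mem_FP (comp_mem_FP hsB fstF_mem_FP)
    (comp_mem_FP dropFn_mem_FP (fanoutFn_mem_FP
      (comp_mem_FP umulFn_mem_FP (fanoutFn_mem_FP sndF_mem_FP (comp_mem_FP hsB fstF_mem_FP)))
      fstF_mem_FP)))

/-! ## The block-parity language -/

variable (s)

/-- **The block-parity language with block length `s`**: strings an odd number of whose `K(|u|)`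
blocks lie in the Tardos witness language `witnessLang F`. [cite: Jukna2012, Thm. 10.21 (PDF pp. 310–311)] -/
def blockParityLang (F : List Bool → List Bool) : Language Bool :=
  {u | Nat.bodd #((range (bpBlocks s u.length)).filter fun j =>
    (witnessLang F).boolIndicator (bpBlock s u j) = true) = true}

variable {s}

/-- Membership in the block-parity language, unfolded. [folklore] -/
theorem mem_blockParityLang {F : List Bool → List Bool} {u : List Bool} :
    u ∈ blockParityLang s F ↔ Nat.bodd #((range (bpBlocks s u.length)).filter fun j =>
      (witnessLang F).boolIndicator (bpBlock s u j) = true) = true :=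
  Iff.rfl

/-- The block test `⟨u, 1ʲ⟩ ↦ [bpBlock s u j ∈ witnessLang F]` as a one-bit brick. [folklore] -/
def bpTestFn (sB F : List Bool → List Bool) : List Bool → List Bool :=
  Oracle.ofLanguage (witnessLang F) ∘ bpBlkFn sB

/-- Value of the block test on a round word. [folklore] -/
theorem bpTestFn_apply {sB : List Bool → List Bool} (hsB : ∀ u, sB u = ones (s u.length))
    (F : List Bool → List Bool) (u : List Bool) (j : ℕ) :
    bpTestFn sB F (boolPair u (ones j)) = [(witnessLang F).boolIndicator (bpBlock s u j)] := by
  simp only [bpTestFn, Function.comp_apply, bpBlkFn_apply hsB, PRelSigma.ofLanguage_eq_singleton]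

/-- The block test is one-bit. [folklore] -/
theorem oneBit_bpTestFn (sB F : List Bool → List Bool) : OneBit (bpTestFn sB F) :=
  (GuardedBall.oneBit_ofLanguage _).comp _

/-- The block test is in `FP` when `F` and the block-length brick are. [cite: AroraBarakCC2009, §1.3] -/
theorem bpTestFn_mem_FP {sB F : List Bool → List Bool} (hsB : sB ∈ FP) (hF : F ∈ FP) :
    bpTestFn sB F ∈ FP :=
  comp_mem_FP (GuardedBall.ofLanguage_mem_FP_of_mem_P (witnessLang_mem_P hF)) (bpBlkFn_mem_FP hsB)

/-- **The decider**: the index-parity loop of the block test with yardstick `bpKFn sB` computes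
the defining parity of the block-parity language. [folklore] -/
theorem parityIdxFn_bp_eq {sB : List Bool → List Bool} (hsB : ∀ u, sB u = ones (s u.length))
    (F : List Bool → List Bool) (u : List Bool) :
    parityIdxFn (bpKFn sB) (bpTestFn sB F) u =
      [Nat.bodd #((range (bpBlocks s u.length)).filter fun j =>
        (witnessLang F).boolIndicator (bpBlock s u j) = true)] := by
  rw [parityIdxFn_apply (oneBit_bpTestFn sB F) (length_bpKFn_le hsB u), bpKFn_apply hsB]
  have hlen : (ones (bpBlocks s u.length)).length = bpBlocks s u.length := by simp [ones]
  rw [hlen]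
  have hfilter : ((range (bpBlocks s u.length)).filter fun i =>
      bpTestFn sB F (boolPair u (ones i)) = [true]) =
      (range (bpBlocks s u.length)).filter fun j =>
        (witnessLang F).boolIndicator (bpBlock s u j) = true := by
    refine Finset.filter_congr fun j _ => ?_
    rw [bpTestFn_apply hsB]
    simp
  rw [hfilter]

/-- **The block-parity language is in `P`** whenever some `FP` brick computes the block length in
unary. [cite: AroraBarakCC2009, §1.3 (bounded loops)] -/
theorem blockParityLang_mem_P {F sB : List Bool → List Bool} (hF : F ∈ FP) (hsBFP : sB ∈ FP)
    (hsB : ∀ u, sB u = ones (s u.length)) : blockParityLang s F ∈ Classes.P := by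
  refine mem_P_of_mem_FP (parityIdxFn_mem_FP (bpKFn_mem_FP hsBFP) (bpTestFn_mem_FP hsBFP hF)
    (oneBit_bpTestFn sB F)) _ fun u => ⟨fun h => ?_, fun h => ?_⟩
  · rw [mem_blockParityLang] at h
    rw [parityIdxFn_bp_eq hsB, h]
  · rw [mem_blockParityLang, Bool.not_eq_true] at h
    rw [parityIdxFn_bp_eq hsB, h]

/-- **The block-parity language is in `NP`** (`P ⊆ NP`). [cite: AroraBarak2009, Claim 2.4] -/
theorem blockParityLang_mem_NP {F sB : List Bool → List Bool} (hF : F ∈ FP) (hsBFP : sB ∈ FP)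
    (hsB : ∀ u, sB u = ones (s u.length)) : blockParityLang s F ∈ Nondeterministic.NP :=
  P_subset_NP_holds (blockParityLang_mem_P hF hsBFP hsB)

/-! ## Slices in terms of blocks -/

/-- The `j`-th block of the input word of a slice, as a function of the block coordinates
(`j · s + i < n` for `j < K = n / s`). [folklore] -/
theorem bpBlock_ofFn {n : ℕ} (x : Fin n → Bool) {j : ℕ} (hj : j < bpBlocks s n) :
    bpBlock s (List.ofFn x) j = List.ofFn fun i : Fin (s n) =>
      x ⟨j * s n + i, by
        have h1 : (j + 1) * s n ≤ n := by
          have := Nat.div_mul_le_self n (s n)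
          have h2 : (j + 1) * s n ≤ (n / s n) * s n := Nat.mul_le_mul_right _ (Nat.succ_le_of_lt hj)
          exact h2.trans this
        have h3 := i.2
        rw [Nat.succ_mul] at h1
        omega⟩ := by
  unfold bpBlock
  rw [List.length_ofFn]
  refine take_drop_ofFn x ?_
  have := Nat.div_mul_le_self n (s n)
  have h2 : (j + 1) * s n ≤ (n / s n) * s n := Nat.mul_le_mul_right _ (Nat.succ_le_of_lt hj)
  rw [Nat.succ_mul] at h2
  exact h2.trans this

/-- **The slice of the block-parity language at length `n`**: the parity of the number of blocks
`j < K(n)` whose block word the slice `(witnessLang F)_{s(n)}` accepts. [folklore] -/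
theorem sliceFn_blockParityLang (F : List Bool → List Bool) {n : ℕ} (x : Fin n → Bool) :
    (blockParityLang s F).sliceFn n x = Nat.bodd #((range (bpBlocks s n)).filter fun j =>
      (witnessLang F).boolIndicator (bpBlock s (List.ofFn x) j) = true) := by
  have h : List.ofFn x ∈ blockParityLang s F ↔ Nat.bodd #((range (bpBlocks s n)).filter fun j =>
      (witnessLang F).boolIndicator (bpBlock s (List.ofFn x) j) = true) = true := by
    rw [mem_blockParityLang, List.length_ofFn]
  show (blockParityLang s F).boolIndicator (List.ofFn x) = _
  rw [Bool.eq_iff_iff]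
  exact (Set.mem_iff_boolIndicator _ _).symm.trans h

end Summit.PneNP.PneNP.Theorems.NegLimNearMarkov

end
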